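import Summits.Ventures.HodgeRepro2.T6MainM2Stmt
import Summits.Ventures.HodgeRepro2.T6NAut4
import Summits.Ventures.HodgeRepro2.T6A1EigenGen
import Summits.Ventures.HodgeRepro2.T6A2ProjectiveSpaceSPVar
import Summits.Ventures.HodgeRepro2.T6A2PointProjective
import Summits.Ventures.HodgeRepro2.T6A2SegreProjective
import Summits.Ventures.HodgeRepro2.T6N3HypHs
import Summits.Ventures.HodgeRepro2.T6N3HypL2Aut
import Summits.Ventures.HodgeRepro2.T6N42RichHost
import Summits.Ventures.HodgeRepro2.T6N5LocalSignModel
import Summits.Ventures.HodgeRepro2.T6N5FockCarrier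
import Summits.Ventures.HodgeRepro2.T6N5SignModelCMDisplaysLi

/-!
# T6MainM3Stmt — THE WAVE-1 RECOMPOSITION, STATEMENT (README §10.4 M2 as amended by TARGET-T6 §11.0; the statement as a `Prop`,
the closed theorem inhabiting it in T6MainM3)

Cell pub-hodge-repro2, Tier 6 (README §10). The lead's file (t6-lead g18), GENERATED MECHANICALLY from the accepted bytes of
T6MainM2Stmt (p417234, sha256 a7d290b3…; 184 binders parsed by folder g18/parse_m2.py, re-emitted by g18/gen_m3.py) — no display is
paraphrased: every binder of `HCCMOfPublished₂` is either KEPT VERBATIM at `(M4 …).toNAut3` (`M ↦ (M4 Bd hB K C).toNAut3`,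
`R ↦ (T Bd hB K C).R`, the five placement data ↦ the bundle's fields, `hKC ↦ toSide_kliftCont`) or REPLACED by the owners' theorems
of WAVE 1 (TARGET-T6 §11.0 decisions (1)–(8); the «## WAVE 1 / HCCMOfPublished₃» section of M10-4-FILELISTS.md), with every NEW
binder introduced by the replacement tagged in the comments by its class for the census ([DATA] [DISPLAY] [RESIDUAL] [EX]
[RE-TYPED]). `HCCMOfPublished₃ : Prop` = «`HostAPI.HCCM.Statement` follows from the published displays and the M3 datum»: the
seven M1 displays of T6MainM1C verbatim (the two Hartshorne displays are THEOREMS now: T6A2SegreProjective / T6A2PointProjective),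
the N side's parameters `Choice Adm τ₁` per Betti datum and corner product (the surface datum is `SurfaceDatum.ofProjectivePlane C`,
T6A2ProjectiveSpaceSPVar; the eigenline generators are `A1EigenGen.eGen K` with `eGen_mem`, T6A1EigenGen), the automorphic datum
`M4 : NAut4 C.F (NDatum.ofHostShadow …)` (T6NAut4, v4: `d3` rich, `d2` from the four line forms, the sides with the N4.1 bundle and
the Bergman-explicit `d43`), and the 180 binders lifted under `∀ Bd hB K [..] C` (187 binders in all, ₂ had 184): the
v7 binders the lanes do not discharge, verbatim, plus the owners' display-level objects where they do. Conclusion: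
`HostAPI.HCCM.Statement`, literally. The proof (T6MainM3) is `hccmOfPublished₂_holds` applied to these binders and the owners'
theorems — M3 = ₂ ∘ (wave 1), nothing of the M2-FINAL cone touched. No new display, no new definition here. §8(d): uses an
L-value-free non-vanishing device: NO.
-/

noncomputable section

open CategoryTheory
open HostAPI.Carriers.AlgebraicGeometry.Motives HostAPI.Carriers.AlgebraicGeometry.HodgeTheory

namespace Summit.Ventures.HodgeRepro2.T6

open Summit.Ventures.HodgeRepro2.T6.Host Summit.Ventures.HodgeRepro2.T6.WeilInst
  Summit.Ventures.HodgeRepro2.T6.WeilAssembly Summit.Ventures.HodgeRepro2.T6.A1HostBridge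
  Summit.Ventures.HodgeRepro2.T6.HostCoeff
open N5Skeleton
open scoped InnerProductSpace

/-- **THE WAVE-1 RECOMPOSITION STATEMENT** (TARGET-T6 §11.0): `HostAPI.HCCM.Statement` — the host's statement of the Hodge
conjecture for complex abelian varieties of CM type, literally — from the seven M1 displays, the N side's parameters `Choice Adm τ₁`
per Betti datum and corner product, the automorphic datum `M4 : NAut4 …` over the host-shadow period datum with the constructed
surface and eigenline generators, and the binders of `HCCMOfPublished₂` not discharged by wave 1 (verbatim at `(M4 …).toNAut3`)
together with the owners' display-level objects that discharge the rest. The `Prop` of record of wave 1; its proof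
`hccmOfPublished₃_holds` is T6MainM3. -/
def HCCMOfPublished₃ : Prop :=
  ∀ (h0 : Hyp.HodgeModelExists) (hS4 : Hyp.Given_S4)
    (hBd : Hyp.BettiHodge coeffC₀) (h17 : Hyp.LangeBirkenhake1992_Lemma1_1_17)
    (hD : ∀ Bd, BettiClauses coeffC₀ Bd → Hyp.LangeBirkenhake1992_Prop1_1_20 Bd)
    (hLefD : ∀ Bd, BettiClauses coeffC₀ Bd → Hyp.Lefschetz11_Betti Bd)
    (hT21 : ∀ Bd, BettiClauses coeffC₀ Bd → Hyp.LangeBirkenhake1992_Thm1_1_21_Betti Bd)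
    -- (a) the N side's parameters per Betti datum and corner product (TIER5 (N0.1)(b), (N0.2)(q2)–(q5)): the choices,
    -- their admissibility, the surface datum `(S, f)` of each choice, the base embedding, the eigenline generators
    (Choice : ∀ (Bd : BettiHodgeData ℂ) (hB : BettiClauses coeffC₀ Bd) (K : Type) [Field K] [NumberField K]
      [IsGalois ℚ K] [NumberField.IsCMField K] (C : CornerProduct K), Type)
    (Adm : ∀ (Bd : BettiHodgeData ℂ) (hB : BettiClauses coeffC₀ Bd) (K : Type) [Field K] [NumberField K]
      [IsGalois ℚ K] [NumberField.IsCMField K] (C : CornerProduct K), Choice Bd hB K C → Prop)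
    (τ₁ : ∀ (Bd : BettiHodgeData ℂ) (hB : BettiClauses coeffC₀ Bd) (K : Type) [Field K] [NumberField K]
      [IsGalois ℚ K] [NumberField.IsCMField K] (C : CornerProduct K), K →+* ℂ)
    -- (a′) THE N SIDE'S PARAMETERS of ₂ that are CONSTRUCTED in ₃ (decision (1), C29 / C33 / C46 / A1 rows 14–15): the surface
    -- datum `surf c := SurfaceDatum.ofProjectivePlane C` (ℙ²_ℂ through the unit section, T6A2ProjectiveSpaceSPVar), the two
    -- Hartshorne displays `hProd` / `hPt` as the theorems `Hyp.Hartshorne1977_productProjective_holds` (T6A2SegreProjective) /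
    -- `Hyp.Hartshorne1977_pointProjective_holds` (T6A2PointProjective), the eigenline generators `e := A1EigenGen.eGen K` with
    -- `e_mem := A1EigenGen.eGen_mem K` (T6A1EigenGen) — six ₂ binders gone (rows 8, 9, 12, 14, 15 + the `surf` argument);
    -- (b′) THE AUTOMORPHIC DATUM, v4 (T6NAut4): the M2 carrier `NAut3` with `d3` the RICH N3 datum (`d3r : N3DatumRich`, decision (7)),
    -- the N2 datum ASSEMBLED from the four line forms (`Fm : N2Forms d3r.toDatum`, `hFm : Fm.IsForm`; `d2 := (N2Rich.ofForms Fm hFm).toDatum`,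
    -- decision (6)), the sides `NSide4` (the N4.1 bundle `d41p : PlacedLDatum`, decision (8); `d43 := (hostFockRecEL n₁ n₂ n₃).toPlaces`,
    -- decision (2)(a)); every ₂ binder stated on `M` is stated on `(M4 …).toNAut3` [DATA, the carrier]
    (M4 : ∀ (Bd : BettiHodgeData ℂ) (hB : BettiClauses coeffC₀ Bd) (K : Type) [Field K] [NumberField K]
      [IsGalois ℚ K] [NumberField.IsCMField K] (C : CornerProduct K), NAut4 C.F (NDatum.ofHostShadow coeffC₀ Bd
      coeffNatural hB C (lemma1117Q_of_display h17) (hD Bd hB) (hLefD Bd hB) (hT21 Bd hB)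
      Hyp.Hartshorne1977_productProjective_holds Hyp.Hartshorne1977_pointProjective_holds (Choice Bd hB K C)
      (Adm Bd hB K C) (fun _ => SurfaceDatum.ofProjectivePlane C) (τ₁ Bd hB K C) (A1EigenGen.eGen K)
      (A1EigenGen.eGen_mem K)))
    -- (c′) the binders of `periodInputN_of_published₇` at `(M4 …).toNAut3`, in v7's order — KEPT VERBATIM where the
    -- lanes discharge nothing (the comments are v7's), REPLACED BY THE OWNERS' THEOREMS where they do (each replacement
    -- block says which rows of ₂ it discharges and how, with the class of every new binder for the census)
    -- v2: every quadruple of Schwartz data is the data of some choice (EX, by construction on the host)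
    (hex : ∀ (Bd : BettiHodgeData ℂ) (hB : BettiClauses coeffC₀ Bd) (K : Type) [Field K] [NumberField K]
      [IsGalois ℚ K] [NumberField.IsCMField K] (C : CornerProduct K), ∀ (φa : (M4 Bd hB K C).toNAut3.d3.A.Sa)
      (φb : (M4 Bd hB K C).toNAut3.d3.A.Sb) (φc : (M4 Bd hB K C).toNAut3.d3.B.Sa) (φd : (M4 Bd hB K
      C).toNAut3.d3.B.Sb), ∃ c, (M4 Bd hB K C).toNAut3.data c = (φa, φb, φc, φd))
    -- RS-N2 (rows 18–22 of ₂: `hfr h₁₁₁ hm he hAdm`) DISCHARGED by the line forms of the carrier (t6-p5, T6N2RichForms):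
    -- `N2Rich.explicitShape_forms₃ M Fm hFm rfl` (.1 .2.1 .2.2.1 .2.2.2) and `N2Rich.admGenerating_forms₃ M Fm hFm rfl` — no binder
    -- here; the forms and their laws are the carrier fields `Fm` / `hFm` [RE-TYPED: DATA 4 + RESIDUAL 4 moved into `M4`, content unchanged]
    -- N3iso (t6-p3): the binders of `N3iso_main₂` — the sentence N2 and N3 share [AD], Rogawski 1990
    -- §14.6 / 14.6.4 / 14.6.5 on the packet carrier `T.R` [displays], the dictionary `hRbr` [AD] and the N3.L8 interface Props [AD];
    -- row 23 `R : RogawskiPackets` RE-TYPED to the print's trace shape `T : RogawskiTrace` (t6-p3, T6N3TraceShape; `T.R` = the packets)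
    -- [DATA, re-typed]
    (T : ∀ (Bd : BettiHodgeData ℂ) (hB : BettiClauses coeffC₀ Bd) (K : Type) [Field K] [NumberField K]
      [IsGalois ℚ K] [NumberField.IsCMField K] (C : CornerProduct K), RogawskiTrace)
    (hR0 : ∀ (Bd : BettiHodgeData ℂ) (hB : BettiClauses coeffC₀ Bd) (K : Type) [Field K] [NumberField K]
      [IsGalois ℚ K] [NumberField.IsCMField K] (C : CornerProduct K), Hyp.Rogawski1990_Sec14_6_Partition (T Bd
      hB K C).R)
    (hR1 : ∀ (Bd : BettiHodgeData ℂ) (hB : BettiClauses coeffC₀ Bd) (K : Type) [Field K] [NumberField K]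
      [IsGalois ℚ K] [NumberField.IsCMField K] (C : CornerProduct K), Hyp.Rogawski1990_Thm14_6_4 (T Bd hB K
      C).R)
    (hR2 : ∀ (Bd : BettiHodgeData ℂ) (hB : BettiClauses coeffC₀ Bd) (K : Type) [Field K] [NumberField K]
      [IsGalois ℚ K] [NumberField.IsCMField K] (C : CornerProduct K), Hyp.Rogawski1990_Thm14_6_5 (T Bd hB K
      C).R)
    -- row 27 `hs` (the Π_s residual [G-N3-3]) DISCHARGED (t6-p3, C43; T6N3HypHs v2 + T6N3MultHs): the identity displayed in the
    -- proof of Proposition 14.6.2 and the §13.3 packet trace [DISPLAY ×2], linear independence of characters, «members unramified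
    -- outside S′» and the one-dimensional residual [RESIDUAL ×3, AD] — `hs` is the theorem `RogawskiTrace.hs_of_identity` (T6N3HsSplice)
    (hI : ∀ (Bd : BettiHodgeData ℂ) (hB : BettiClauses coeffC₀ Bd) (K : Type) [Field K] [NumberField K]
      [IsGalois ℚ K] [NumberField.IsCMField K] (C : CornerProduct K), Hyp.Rogawski1990_Prop14_6_2_Identity (T Bd
      hB K C))
    (hE : ∀ (Bd : BettiHodgeData ℂ) (hB : BettiClauses coeffC₀ Bd) (K : Type) [Field K] [NumberField K]
      [IsGalois ℚ K] [NumberField.IsCMField K] (C : CornerProduct K), Hyp.Rogawski1990_Sec13_3_PacketTrace (T Bd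
      hB K C))
    (hLI : ∀ (Bd : BettiHodgeData ℂ) (hB : BettiClauses coeffC₀ Bd) (K : Type) [Field K] [NumberField K]
      [IsGalois ℚ K] [NumberField.IsCMField K] (C : CornerProduct K), (T Bd hB K C).CharLinIndep)
    (hU : ∀ (Bd : BettiHodgeData ℂ) (hB : BettiClauses coeffC₀ Bd) (K : Type) [Field K] [NumberField K]
      [IsGalois ℚ K] [NumberField.IsCMField K] (C : CornerProduct K), (T Bd hB K C).MembersUnramified)
    (hOne : ∀ (Bd : BettiHodgeData ℂ) (hB : BettiClauses coeffC₀ Bd) (K : Type) [Field K] [NumberField K]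
      [IsGalois ℚ K] [NumberField.IsCMField K] (C : CornerProduct K), (T Bd hB K C).OneDimMultLeOne)
    (hst : ∀ (Bd : BettiHodgeData ℂ) (hB : BettiClauses coeffC₀ Bd) (K : Type) [Field K] [NumberField K]
      [IsGalois ℚ K] [NumberField.IsCMField K] (C : CornerProduct K), (M4 Bd hB K C).toNAut3.d3.AutStable)
    (hRbr : ∀ (Bd : BettiHodgeData ℂ) (hB : BettiClauses coeffC₀ Bd) (K : Type) [Field K] [NumberField K]
      [IsGalois ℚ K] [NumberField.IsCMField K] (C : CornerProduct K), (M4 Bd hB K C).toNAut3.d3.RogawskiBridge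
      (T Bd hB K C).R (hst Bd hB K C))
    (hO : ∀ (Bd : BettiHodgeData ℂ) (hB : BettiClauses coeffC₀ Bd) (K : Type) [Field K] [NumberField K]
      [IsGalois ℚ K] [NumberField.IsCMField K] (C : CornerProduct K), (M4 Bd hB K C).toNAut3.d3.AutOrthogonal)
    (hsimp : ∀ (Bd : BettiHodgeData ℂ) (hB : BettiClauses coeffC₀ Bd) (K : Type) [Field K] [NumberField K]
      [IsGalois ℚ K] [NumberField.IsCMField K] (C : CornerProduct K), (M4 Bd hB K C).toNAut3.d3.AutSimple)
    (hPX : ∀ (Bd : BettiHodgeData ℂ) (hB : BettiClauses coeffC₀ Bd) (K : Type) [Field K] [NumberField K]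
      [IsGalois ℚ K] [NumberField.IsCMField K] (C : CornerProduct K), (M4 Bd hB K C).toNAut3.d3.ProductsIn20 (M4
      Bd hB K C).toNAut3.d3.A)
    (hPeqX : ∀ (Bd : BettiHodgeData ℂ) (hB : BettiClauses coeffC₀ Bd) (K : Type) [Field K] [NumberField K]
      [IsGalois ℚ K] [NumberField.IsCMField K] (C : CornerProduct K), (M4 Bd hB K
      C).toNAut3.d3.ProductEquivariant (M4 Bd hB K C).toNAut3.d3.A)
    (hPY : ∀ (Bd : BettiHodgeData ℂ) (hB : BettiClauses coeffC₀ Bd) (K : Type) [Field K] [NumberField K]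
      [IsGalois ℚ K] [NumberField.IsCMField K] (C : CornerProduct K), (M4 Bd hB K C).toNAut3.d3.ProductsIn20 (M4
      Bd hB K C).toNAut3.d3.B)
    (hPeqY : ∀ (Bd : BettiHodgeData ℂ) (hB : BettiClauses coeffC₀ Bd) (K : Type) [Field K] [NumberField K]
      [IsGalois ℚ K] [NumberField.IsCMField K] (C : CornerProduct K), (M4 Bd hB K
      C).toNAut3.d3.ProductEquivariant (M4 Bd hB K C).toNAut3.d3.B)
    (hσX : ∀ (Bd : BettiHodgeData ℂ) (hB : BettiClauses coeffC₀ Bd) (K : Type) [Field K] [NumberField K]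
      [IsGalois ℚ K] [NumberField.IsCMField K] (C : CornerProduct K), (M4 Bd hB K C).toNAut3.d3.SigmaIsAut (M4
      Bd hB K C).toNAut3.d3.A)
    (hσ : ∀ (Bd : BettiHodgeData ℂ) (hB : BettiClauses coeffC₀ Bd) (K : Type) [Field K] [NumberField K]
      [IsGalois ℚ K] [NumberField.IsCMField K] (C : CornerProduct K), (M4 Bd hB K C).toNAut3.d3.B.σ = (M4 Bd hB
      K C).toNAut3.d3.A.σ)
    -- N1 (t6-p1): the four displays of T6N1Hyp on the carrier's N1 datum
    (hN1H : ∀ (Bd : BettiHodgeData ℂ) (hB : BettiClauses coeffC₀ Bd) (K : Type) [Field K] [NumberField K]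
      [IsGalois ℚ K] [NumberField.IsCMField K] (C : CornerProduct K), Hyp.Voisin2002_7_3_2 (M4 Bd hB K
      C).toNAut3.d1)
    (hN1L : ∀ (Bd : BettiHodgeData ℂ) (hB : BettiClauses coeffC₀ Bd) (K : Type) [Field K] [NumberField K]
      [IsGalois ℚ K] [NumberField.IsCMField K] (C : CornerProduct K), Hyp.Voisin2002_Lemma5_4_petersson (M4 Bd
      hB K C).toNAut3.d1)
    (hN1A : ∀ (Bd : BettiHodgeData ℂ) (hB : BettiClauses coeffC₀ Bd) (K : Type) [Field K] [NumberField K]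
      [IsGalois ℚ K] [NumberField.IsCMField K] (C : CornerProduct K), Hyp.Liu2021_Prop4_13_vertexLiftA (M4 Bd hB
      K C).toNAut3.d1)
    (hN1B : ∀ (Bd : BettiHodgeData ℂ) (hB : BettiClauses coeffC₀ Bd) (K : Type) [Field K] [NumberField K]
      [IsGalois ℚ K] [NumberField.IsCMField K] (C : CornerProduct K), Hyp.Liu2021_Prop4_13_vertexLiftB (M4 Bd hB
      K C).toNAut3.d1)
    -- N3A (t6-p3): Gan–Takeda at the non-archimedean places + the class-AD interface Props, side A
    (ιA : ∀ (Bd : BettiHodgeData ℂ) (hB : BettiClauses coeffC₀ Bd) (K : Type) [Field K] [NumberField K]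
      [IsGalois ℚ K] [NumberField.IsCMField K] (C : CornerProduct K), Type)
    (LA : ∀ (Bd : BettiHodgeData ℂ) (hB : BettiClauses coeffC₀ Bd) (K : Type) [Field K] [NumberField K]
      [IsGalois ℚ K] [NumberField.IsCMField K] (C : CornerProduct K), (ιA Bd hB K C) → HoweDualityShape)
    (hHDA : ∀ (Bd : BettiHodgeData ℂ) (hB : BettiClauses coeffC₀ Bd) (K : Type) [Field K] [NumberField K]
      [IsGalois ℚ K] [NumberField.IsCMField K] (C : CornerProduct K), ∀ v, Hyp.GanTakeda2016_Thm1_2 ((LA Bd hB K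
      C) v))
    (hHDbrA : ∀ (Bd : BettiHodgeData ℂ) (hB : BettiClauses coeffC₀ Bd) (K : Type) [Field K] [NumberField K]
      [IsGalois ℚ K] [NumberField.IsCMField K] (C : CornerProduct K), (M4 Bd hB K
      C).toNAut3.d3.HoweDualityBridge (LA Bd hB K C) (M4 Bd hB K C).toNAut3.d3.A)
    -- N3 side A (t6-p3, decision (7)): `hKC` / `hAdj` / `hO` / `hTS` are the theorems `N3SideRich.toSide_kliftCont` /
    -- `toSide_adjoint` / `toSide_copiesOrthogonal` / `toSide_tensorsSpan` of the rich side (RESIDUAL −4 per side, C39); the seam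
    -- `hSeam` is stated on `toSide_kliftCont`; the other interface Props stay [AD]
    (hSeamA : ∀ (Bd : BettiHodgeData ℂ) (hB : BettiClauses coeffC₀ Bd) (K : Type) [Field K] [NumberField K]
      [IsGalois ℚ K] [NumberField.IsCMField K] (C : CornerProduct K), (M4 Bd hB K C).toNAut3.d3.A.Seam (M4 Bd hB
      K C).d3r.A.toSide_kliftCont)
    (hKLA : ∀ (Bd : BettiHodgeData ℂ) (hB : BettiClauses coeffC₀ Bd) (K : Type) [Field K] [NumberField K]
      [IsGalois ℚ K] [NumberField.IsCMField K] (C : CornerProduct K), (M4 Bd hB K C).toNAut3.d3.A.KliftLevel)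
    (hΘτA : ∀ (Bd : BettiHodgeData ℂ) (hB : BettiClauses coeffC₀ Bd) (K : Type) [Field K] [NumberField K]
      [IsGalois ℚ K] [NumberField.IsCMField K] (C : CornerProduct K), (M4 Bd hB K C).toNAut3.d3.A.ThetaTauType
      (M4 Bd hB K C).toNAut3.d3.τiso)
    (hEA : ∀ (Bd : BettiHodgeData ℂ) (hB : BettiClauses coeffC₀ Bd) (K : Type) [Field K] [NumberField K]
      [IsGalois ℚ K] [NumberField.IsCMField K] (C : CornerProduct K), (M4 Bd hB K
      C).toNAut3.d3.A.CopiesEquivariant)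
    (hInclA : ∀ (Bd : BettiHodgeData ℂ) (hB : BettiClauses coeffC₀ Bd) (K : Type) [Field K] [NumberField K]
      [IsGalois ℚ K] [NumberField.IsCMField K] (C : CornerProduct K), (M4 Bd hB K C).toNAut3.d3.A.CopiesIncl)
    (hTauA : ∀ (Bd : BettiHodgeData ℂ) (hB : BettiClauses coeffC₀ Bd) (K : Type) [Field K] [NumberField K]
      [IsGalois ℚ K] [NumberField.IsCMField K] (C : CornerProduct K), (M4 Bd hB K C).toNAut3.d3.A.CopiesTauType)
    (hDecA : ∀ (Bd : BettiHodgeData ℂ) (hB : BettiClauses coeffC₀ Bd) (K : Type) [Field K] [NumberField K]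
      [IsGalois ℚ K] [NumberField.IsCMField K] (C : CornerProduct K), (M4 Bd hB K
      C).toNAut3.d3.A.TauTypeDecomposes)
    (hFA : ∀ (Bd : BettiHodgeData ℂ) (hB : BettiClauses coeffC₀ Bd) (K : Type) [Field K] [NumberField K]
      [IsGalois ℚ K] [NumberField.IsCMField K] (C : CornerProduct K), (M4 Bd hB K
      C).toNAut3.d3.A.LevelPartFinite)
    (hCA : ∀ (Bd : BettiHodgeData ℂ) (hB : BettiClauses coeffC₀ Bd) (K : Type) [Field K] [NumberField K]
      [IsGalois ℚ K] [NumberField.IsCMField K] (C : CornerProduct K), (M4 Bd hB K C).toNAut3.d3.A.LevelPartCont)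
    (hAvgA : ∀ (Bd : BettiHodgeData ℂ) (hB : BettiClauses coeffC₀ Bd) (K : Type) [Field K] [NumberField K]
      [IsGalois ℚ K] [NumberField.IsCMField K] (C : CornerProduct K), (M4 Bd hB K C).toNAut3.d3.A.KAverage)
    (hEqA : ∀ (Bd : BettiHodgeData ℂ) (hB : BettiClauses coeffC₀ Bd) (K : Type) [Field K] [NumberField K]
      [IsGalois ℚ K] [NumberField.IsCMField K] (C : CornerProduct K), (M4 Bd hB K
      C).toNAut3.d3.A.ThetaEquivariant)
    (hSpanA : ∀ (Bd : BettiHodgeData ℂ) (hB : BettiClauses coeffC₀ Bd) (K : Type) [Field K] [NumberField K]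
      [IsGalois ℚ K] [NumberField.IsCMField K] (C : CornerProduct K), (M4 Bd hB K
      C).toNAut3.d3.A.SpanOfFixedVector)
    (hCOA : ∀ (Bd : BettiHodgeData ℂ) (hB : BettiClauses coeffC₀ Bd) (K : Type) [Field K] [NumberField K]
      [IsGalois ℚ K] [NumberField.IsCMField K] (C : CornerProduct K), (M4 Bd hB K
      C).toNAut3.d3.A.CrossCopyOrthogonal)
    (hIndA : ∀ (Bd : BettiHodgeData ℂ) (hB : BettiClauses coeffC₀ Bd) (K : Type) [Field K] [NumberField K]
      [IsGalois ℚ K] [NumberField.IsCMField K] (C : CornerProduct K), (M4 Bd hB K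
      C).toNAut3.d3.A.CopyIndependence)
    -- N3B (t6-p3): the same on side B
    (ιB : ∀ (Bd : BettiHodgeData ℂ) (hB : BettiClauses coeffC₀ Bd) (K : Type) [Field K] [NumberField K]
      [IsGalois ℚ K] [NumberField.IsCMField K] (C : CornerProduct K), Type)
    (LB : ∀ (Bd : BettiHodgeData ℂ) (hB : BettiClauses coeffC₀ Bd) (K : Type) [Field K] [NumberField K]
      [IsGalois ℚ K] [NumberField.IsCMField K] (C : CornerProduct K), (ιB Bd hB K C) → HoweDualityShape)
    (hHDB : ∀ (Bd : BettiHodgeData ℂ) (hB : BettiClauses coeffC₀ Bd) (K : Type) [Field K] [NumberField K]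
      [IsGalois ℚ K] [NumberField.IsCMField K] (C : CornerProduct K), ∀ v, Hyp.GanTakeda2016_Thm1_2 ((LB Bd hB K
      C) v))
    (hHDbrB : ∀ (Bd : BettiHodgeData ℂ) (hB : BettiClauses coeffC₀ Bd) (K : Type) [Field K] [NumberField K]
      [IsGalois ℚ K] [NumberField.IsCMField K] (C : CornerProduct K), (M4 Bd hB K
      C).toNAut3.d3.HoweDualityBridge (LB Bd hB K C) (M4 Bd hB K C).toNAut3.d3.B)
    (hSeamB : ∀ (Bd : BettiHodgeData ℂ) (hB : BettiClauses coeffC₀ Bd) (K : Type) [Field K] [NumberField K]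
      [IsGalois ℚ K] [NumberField.IsCMField K] (C : CornerProduct K), (M4 Bd hB K C).toNAut3.d3.B.Seam (M4 Bd hB
      K C).d3r.B.toSide_kliftCont)
    (hKLB : ∀ (Bd : BettiHodgeData ℂ) (hB : BettiClauses coeffC₀ Bd) (K : Type) [Field K] [NumberField K]
      [IsGalois ℚ K] [NumberField.IsCMField K] (C : CornerProduct K), (M4 Bd hB K C).toNAut3.d3.B.KliftLevel)
    (hΘτB : ∀ (Bd : BettiHodgeData ℂ) (hB : BettiClauses coeffC₀ Bd) (K : Type) [Field K] [NumberField K]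
      [IsGalois ℚ K] [NumberField.IsCMField K] (C : CornerProduct K), (M4 Bd hB K C).toNAut3.d3.B.ThetaTauType
      (M4 Bd hB K C).toNAut3.d3.τiso)
    (hEB : ∀ (Bd : BettiHodgeData ℂ) (hB : BettiClauses coeffC₀ Bd) (K : Type) [Field K] [NumberField K]
      [IsGalois ℚ K] [NumberField.IsCMField K] (C : CornerProduct K), (M4 Bd hB K
      C).toNAut3.d3.B.CopiesEquivariant)
    (hInclB : ∀ (Bd : BettiHodgeData ℂ) (hB : BettiClauses coeffC₀ Bd) (K : Type) [Field K] [NumberField K]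
      [IsGalois ℚ K] [NumberField.IsCMField K] (C : CornerProduct K), (M4 Bd hB K C).toNAut3.d3.B.CopiesIncl)
    (hTauB : ∀ (Bd : BettiHodgeData ℂ) (hB : BettiClauses coeffC₀ Bd) (K : Type) [Field K] [NumberField K]
      [IsGalois ℚ K] [NumberField.IsCMField K] (C : CornerProduct K), (M4 Bd hB K C).toNAut3.d3.B.CopiesTauType)
    (hDecB : ∀ (Bd : BettiHodgeData ℂ) (hB : BettiClauses coeffC₀ Bd) (K : Type) [Field K] [NumberField K]
      [IsGalois ℚ K] [NumberField.IsCMField K] (C : CornerProduct K), (M4 Bd hB K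
      C).toNAut3.d3.B.TauTypeDecomposes)
    (hFB : ∀ (Bd : BettiHodgeData ℂ) (hB : BettiClauses coeffC₀ Bd) (K : Type) [Field K] [NumberField K]
      [IsGalois ℚ K] [NumberField.IsCMField K] (C : CornerProduct K), (M4 Bd hB K
      C).toNAut3.d3.B.LevelPartFinite)
    (hCB : ∀ (Bd : BettiHodgeData ℂ) (hB : BettiClauses coeffC₀ Bd) (K : Type) [Field K] [NumberField K]
      [IsGalois ℚ K] [NumberField.IsCMField K] (C : CornerProduct K), (M4 Bd hB K C).toNAut3.d3.B.LevelPartCont)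
    (hAvgB : ∀ (Bd : BettiHodgeData ℂ) (hB : BettiClauses coeffC₀ Bd) (K : Type) [Field K] [NumberField K]
      [IsGalois ℚ K] [NumberField.IsCMField K] (C : CornerProduct K), (M4 Bd hB K C).toNAut3.d3.B.KAverage)
    (hEqB : ∀ (Bd : BettiHodgeData ℂ) (hB : BettiClauses coeffC₀ Bd) (K : Type) [Field K] [NumberField K]
      [IsGalois ℚ K] [NumberField.IsCMField K] (C : CornerProduct K), (M4 Bd hB K
      C).toNAut3.d3.B.ThetaEquivariant)
    (hSpanB : ∀ (Bd : BettiHodgeData ℂ) (hB : BettiClauses coeffC₀ Bd) (K : Type) [Field K] [NumberField K]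
      [IsGalois ℚ K] [NumberField.IsCMField K] (C : CornerProduct K), (M4 Bd hB K
      C).toNAut3.d3.B.SpanOfFixedVector)
    (hCOB : ∀ (Bd : BettiHodgeData ℂ) (hB : BettiClauses coeffC₀ Bd) (K : Type) [Field K] [NumberField K]
      [IsGalois ℚ K] [NumberField.IsCMField K] (C : CornerProduct K), (M4 Bd hB K
      C).toNAut3.d3.B.CrossCopyOrthogonal)
    (hIndB : ∀ (Bd : BettiHodgeData ℂ) (hB : BettiClauses coeffC₀ Bd) (K : Type) [Field K] [NumberField K]
      [IsGalois ℚ K] [NumberField.IsCMField K] (C : CornerProduct K), (M4 Bd hB K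
      C).toNAut3.d3.B.CopyIndependence)
    -- N4 (t6-p4): the binders of `N4_main`, verbatim, except (i) the N4.2 block `hIS hpos hnm hFL` per side — `hIS` / `hFL` DISCHARGED
    -- from the DISPLAY-LEVEL host objects (t6-p5, decision (6), the `hFL` interface reading: T6N42HypFlath v2, T6N42FlathDatum,
    -- T6N42FlathLiftHost, T6N42RichHost; the shared «π₀^∞ admissible irreducible» display of t6-p3, T6N3HypL2Aut, consumed AT THE
    -- CARRIER'S OWN π₀ ⊂ L²([H]) through `NAut4.shapeA/B`): per side the L2Aut shape data [DATA ×3], Getz–Hahn 2024 Thm 6.5.2 [DISPLAY],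
    -- `IsL2Aut π₀` / `IsFinitePart π₀` [RESIDUAL ×2], Getz–Hahn 2024 Thm 5.7.1 + the §5.7 note [DISPLAY ×2], the places and readings
    -- of π₀,v [DATA ×4] with their laws [RESIDUAL ×2], the first-lift side `F` [DATA] with its laws [RESIDUAL], its reading at every
    -- non-split place [DATA] with its laws [RESIDUAL], `hpos` / `hnm` as in ₂ [RESIDUAL ×2]; (ii) the six (I-P2) binders and (iii) the
    -- N4.1 placement data — see the blocks below
    (S_shA : ∀ (Bd : BettiHodgeData ℂ) (hB : BettiClauses coeffC₀ Bd) (K : Type) [Field K] [NumberField K]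
      [IsGalois ℚ K] [NumberField.IsCMField K] (C : CornerProduct K), N42Flath.FactorizationShape)
    (IsL2AutA : ∀ (Bd : BettiHodgeData ℂ) (hB : BettiClauses coeffC₀ Bd) (K : Type) [Field K] [NumberField K]
      [IsGalois ℚ K] [NumberField.IsCMField K] (C : CornerProduct K), Submodule ℂ (M4 Bd hB K C).d3r.A.LH →
      Prop)
    (IsFinA : ∀ (Bd : BettiHodgeData ℂ) (hB : BettiClauses coeffC₀ Bd) (K : Type) [Field K] [NumberField K]
      [IsGalois ℚ K] [NumberField.IsCMField K] (C : CornerProduct K), Submodule ℂ (M4 Bd hB K C).d3r.A.LH →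
      Prop)
    (hL2A : ∀ (Bd : BettiHodgeData ℂ) (hB : BettiClauses coeffC₀ Bd) (K : Type) [Field K] [NumberField K]
      [IsGalois ℚ K] [NumberField.IsCMField K] (C : CornerProduct K), Hyp.GetzHahn2024_Thm6_5_2 ((M4 Bd hB K
      C).shapeA (S_shA Bd hB K C) (IsL2AutA Bd hB K C) (IsFinA Bd hB K C)))
    (hAutA : ∀ (Bd : BettiHodgeData ℂ) (hB : BettiClauses coeffC₀ Bd) (K : Type) [Field K] [NumberField K]
      [IsGalois ℚ K] [NumberField.IsCMField K] (C : CornerProduct K), (IsL2AutA Bd hB K C) (M4 Bd hB K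
      C).d3r.A.π₀)
    (hFinA : ∀ (Bd : BettiHodgeData ℂ) (hB : BettiClauses coeffC₀ Bd) (K : Type) [Field K] [NumberField K]
      [IsGalois ℚ K] [NumberField.IsCMField K] (C : CornerProduct K), (IsFinA Bd hB K C) (M4 Bd hB K
      C).d3r.A.π₀)
    (h571A : ∀ (Bd : BettiHodgeData ℂ) (hB : BettiClauses coeffC₀ Bd) (K : Type) [Field K] [NumberField K]
      [IsGalois ℚ K] [NumberField.IsCMField K] (C : CornerProduct K), Hyp.GetzHahn2024_Thm5_7_1 (S_shA Bd hB K
      C))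
    (h57nA : ∀ (Bd : BettiHodgeData ℂ) (hB : BettiClauses coeffC₀ Bd) (K : Type) [Field K] [NumberField K]
      [IsGalois ℚ K] [NumberField.IsCMField K] (C : CornerProduct K), Hyp.GetzHahn2024_Sec5_7_Note (S_shA Bd hB
      K C))
    (spA : ∀ (Bd : BettiHodgeData ℂ) (hB : BettiClauses coeffC₀ Bd) (K : Type) [Field K] [NumberField K]
      [IsGalois ℚ K] [NumberField.IsCMField K] (C : CornerProduct K), (M4 Bd hB K C).toNAut3.sA.d42.SplitPlace →
      (S_shA Bd hB K C).Place)
    (nsA : ∀ (Bd : BettiHodgeData ℂ) (hB : BettiClauses coeffC₀ Bd) (K : Type) [Field K] [NumberField K]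
      [IsGalois ℚ K] [NumberField.IsCMField K] (C : CornerProduct K), (M4 Bd hB K
      C).toNAut3.sA.d42.NonsplitPlace → (S_shA Bd hB K C).Place)
    (readSplitA : ∀ (Bd : BettiHodgeData ℂ) (hB : BettiClauses coeffC₀ Bd) (K : Type) [Field K] [NumberField K]
      [IsGalois ℚ K] [NumberField.IsCMField K] (C : CornerProduct K), ∀ v, N42Flath.ReadAs ((S_shA Bd hB K
      C).components (h571A Bd hB K C) (h57nA Bd hB K C) ((hL2A Bd hB K C) (hAutA Bd hB K C) (hFinA Bd hB K C))
      (spA Bd hB K C v)) ((M4 Bd hB K C).toNAut3.sA.d42.splitDatum v).pair.π)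
    (readNonsplitA : ∀ (Bd : BettiHodgeData ℂ) (hB : BettiClauses coeffC₀ Bd) (K : Type) [Field K] [NumberField K]
      [IsGalois ℚ K] [NumberField.IsCMField K] (C : CornerProduct K), ∀ v, N42Flath.ReadAs ((S_shA Bd hB K
      C).components (h571A Bd hB K C) (h57nA Bd hB K C) ((hL2A Bd hB K C) (hAutA Bd hB K C) (hFinA Bd hB K C))
      (nsA Bd hB K C v)) ((M4 Bd hB K C).toNAut3.sA.d42.towerDatum v).π)
    (hspA : ∀ (Bd : BettiHodgeData ℂ) (hB : BettiClauses coeffC₀ Bd) (K : Type) [Field K] [NumberField K]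
      [IsGalois ℚ K] [NumberField.IsCMField K] (C : CornerProduct K), ∀ v, (readSplitA Bd hB K C v).IsReading)
    (hnsA : ∀ (Bd : BettiHodgeData ℂ) (hB : BettiClauses coeffC₀ Bd) (K : Type) [Field K] [NumberField K]
      [IsGalois ℚ K] [NumberField.IsCMField K] (C : CornerProduct K), ∀ v, (readNonsplitA Bd hB K C
      v).IsReading)
    (FA : ∀ (Bd : BettiHodgeData ℂ) (hB : BettiClauses coeffC₀ Bd) (K : Type) [Field K] [NumberField K]
      [IsGalois ℚ K] [NumberField.IsCMField K] (C : CornerProduct K), N42Flath.FirstLiftSide (M4 Bd hB K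
      C).d3r.A.LH (M4 Bd hB K C).d3r.A.Hf (M4 Bd hB K C).d3r.A.R (M4 Bd hB K C).d3r.A.π₀)
    (hLiftA : ∀ (Bd : BettiHodgeData ℂ) (hB : BettiClauses coeffC₀ Bd) (K : Type) [Field K] [NumberField K]
      [IsGalois ℚ K] [NumberField.IsCMField K] (C : CornerProduct K), (FA Bd hB K C).IsLift)
    (readA : ∀ (Bd : BettiHodgeData ℂ) (hB : BettiClauses coeffC₀ Bd) (K : Type) [Field K] [NumberField K]
      [IsGalois ℚ K] [NumberField.IsCMField K] (C : CornerProduct K), ∀ v : (M4 Bd hB K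
      C).toNAut3.sA.d42.NonsplitPlace, N42Flath.ReadAtPlace ((FA Bd hB K C).toGlobalLiftDatum (hLiftA Bd hB K
      C)) (((M4 Bd hB K C).toNAut3.sA.d42.towerDatum v).ω 0) ((M4 Bd hB K C).toNAut3.sA.d42.towerDatum v).π
      (T5TrivialPartner.charLinRep ((M4 Bd hB K C).toNAut3.sA.d42.β' v)))
    (hreadA : ∀ (Bd : BettiHodgeData ℂ) (hB : BettiClauses coeffC₀ Bd) (K : Type) [Field K] [NumberField K]
      [IsGalois ℚ K] [NumberField.IsCMField K] (C : CornerProduct K), ∀ v, (readA Bd hB K C v).IsReading)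
    (hposA : ∀ (Bd : BettiHodgeData ℂ) (hB : BettiClauses coeffC₀ Bd) (K : Type) [Field K] [NumberField K]
      [IsGalois ℚ K] [NumberField.IsCMField K] (C : CornerProduct K), ∀ v, 0 < ((M4 Bd hB K
      C).toNAut3.sA.d42.splitDatum v).n)
    (hnmA : ∀ (Bd : BettiHodgeData ℂ) (hB : BettiClauses coeffC₀ Bd) (K : Type) [Field K] [NumberField K]
      [IsGalois ℚ K] [NumberField.IsCMField K] (C : CornerProduct K), (M4 Bd hB K C).toNAut3.sA.d42.TypeIISizes)
    (hMA : ∀ (Bd : BettiHodgeData ℂ) (hB : BettiClauses coeffC₀ Bd) (K : Type) [Field K] [NumberField K]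
      [IsGalois ℚ K] [NumberField.IsCMField K] (C : CornerProduct K), ∀ v, Hyp.Minguez2008_Theoreme1_2 ((M4 Bd
      hB K C).toNAut3.sA.d42.splitDatum v))
    (hGIA : ∀ (Bd : BettiHodgeData ℂ) (hB : BettiClauses coeffC₀ Bd) (K : Type) [Field K] [NumberField K]
      [IsGalois ℚ K] [NumberField.IsCMField K] (C : CornerProduct K), ∀ v, Hyp.GanIchino2014_Prop5_3_i ((M4 Bd
      hB K C).toNAut3.sA.d42.towerDatum v))
    -- (ii) the six (I-P2) binders per side (`hEL₁ hA2f₂ hEL₂ hA2f₃ hEL₃`, rows 95–99 / 138–142 of ₂) and the Bergman bundles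
    -- `XA XB` with `hxA hxB` (rows 86–88) are THEOREMS on the carrier (t6-p6, decision (2)(a), C45: `d43 := (hostFockRecEL n₁ n₂ n₃).toPlaces`
    -- by definition of `NSide4`, `hx* := rfl`, `NSide4.hEL₁/₂/₃` from `hostFockRecEL_EL₁/₂/₃` through `Lv_arch`, `NSide4.hA2f₂/₃` from
    -- `hostFockRecEL_A2f₂/₃`); the three GQT displays `hB₁..₃` stay [DISPLAY]
    (hB₁A : ∀ (Bd : BettiHodgeData ℂ) (hB : BettiClauses coeffC₀ Bd) (K : Type) [Field K] [NumberField K]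
      [IsGalois ℚ K] [NumberField.IsCMField K] (C : CornerProduct K), Hyp.GQT2014_Conj11_5_obvious ((M4 Bd hB K
      C).toNAut3.sA.d43.withLfac fun j => (M4 Bd hB K C).toNAut3.sA.d41.Lv (Sum.inr j)).d₁ (M4 Bd hB K
      C).toNAut3.sA.d41 (Sum.inr 0))
    (hB₂A : ∀ (Bd : BettiHodgeData ℂ) (hB : BettiClauses coeffC₀ Bd) (K : Type) [Field K] [NumberField K]
      [IsGalois ℚ K] [NumberField.IsCMField K] (C : CornerProduct K), Hyp.GQT2014_Conj11_5_obvious ((M4 Bd hB K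
      C).toNAut3.sA.d43.withLfac fun j => (M4 Bd hB K C).toNAut3.sA.d41.Lv (Sum.inr j)).d₂ (M4 Bd hB K
      C).toNAut3.sA.d41 (Sum.inr 1))
    (hB₃A : ∀ (Bd : BettiHodgeData ℂ) (hB : BettiClauses coeffC₀ Bd) (K : Type) [Field K] [NumberField K]
      [IsGalois ℚ K] [NumberField.IsCMField K] (C : CornerProduct K), Hyp.GQT2014_Conj11_5_obvious ((M4 Bd hB K
      C).toNAut3.sA.d43.withLfac fun j => (M4 Bd hB K C).toNAut3.sA.d41.Lv (Sum.inr j)).d₃ (M4 Bd hB K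
      C).toNAut3.sA.d41 (Sum.inr 2))
    (hGQTA : ∀ (Bd : BettiHodgeData ℂ) (hB : BettiClauses coeffC₀ Bd) (K : Type) [Field K] [NumberField K]
      [IsGalois ℚ K] [NumberField.IsCMField K] (C : CornerProduct K), Hyp.GQT2014_Thm11_4_ii (M4 Bd hB K
      C).toNAut3.sA.d41)
    (hLRA : ∀ (Bd : BettiHodgeData ℂ) (hB : BettiClauses coeffC₀ Bd) (K : Type) [Field K] [NumberField K]
      [IsGalois ℚ K] [NumberField.IsCMField K] (C : CornerProduct K), Hyp.LapidRallis2005_Sec10_GlobalL (M4 Bd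
      hB K C).toNAut3.sA.d41)
    (hpadicA : ∀ (Bd : BettiHodgeData ℂ) (hB : BettiClauses coeffC₀ Bd) (K : Type) [Field K] [NumberField K]
      [IsGalois ℚ K] [NumberField.IsCMField K] (C : CornerProduct K), Hyp.LapidRallis2005_Sec10_padic (M4 Bd hB
      K C).toNAut3.sA.d41 (M4 Bd hB K C).toNAut3.sA.archSet)
    (hI₁eA : ∀ (Bd : BettiHodgeData ℂ) (hB : BettiClauses coeffC₀ Bd) (K : Type) [Field K] [NumberField K]
      [IsGalois ℚ K] [NumberField.IsCMField K] (C : CornerProduct K), Hyp.Iwasawa2019_Sec3_1_EulerProductE (M4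
      Bd hB K C).toNAut3.sA.d41.L₁ (M4 Bd hB K C).toNAut3.sA.d41.g₁)
    (hI₂eA : ∀ (Bd : BettiHodgeData ℂ) (hB : BettiClauses coeffC₀ Bd) (K : Type) [Field K] [NumberField K]
      [IsGalois ℚ K] [NumberField.IsCMField K] (C : CornerProduct K), Hyp.Iwasawa2019_Sec3_1_EulerProductE (M4
      Bd hB K C).toNAut3.sA.d41.L₂ (M4 Bd hB K C).toNAut3.sA.d41.g₂)
    (hI₁A : ∀ (Bd : BettiHodgeData ℂ) (hB : BettiClauses coeffC₀ Bd) (K : Type) [Field K] [NumberField K]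
      [IsGalois ℚ K] [NumberField.IsCMField K] (C : CornerProduct K), Hyp.Iwasawa2019_Thm3_1 (M4 Bd hB K
      C).toNAut3.sA.d41.L₁ (M4 Bd hB K C).toNAut3.sA.d41.triv₁)
    (hI₂A : ∀ (Bd : BettiHodgeData ℂ) (hB : BettiClauses coeffC₀ Bd) (K : Type) [Field K] [NumberField K]
      [IsGalois ℚ K] [NumberField.IsCMField K] (C : CornerProduct K), Hyp.Iwasawa2019_Thm3_1 (M4 Bd hB K
      C).toNAut3.sA.d41.L₂ (M4 Bd hB K C).toNAut3.sA.d41.triv₂)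
    (hP₁A : ∀ (Bd : BettiHodgeData ℂ) (hB : BettiClauses coeffC₀ Bd) (K : Type) [Field K] [NumberField K]
      [IsGalois ℚ K] [NumberField.IsCMField K] (C : CornerProduct K), Hyp.Iwasawa2019_Prop4_4 (M4 Bd hB K
      C).toNAut3.sA.d41.L₁ (M4 Bd hB K C).toNAut3.sA.d41.triv₁)
    (hP₂A : ∀ (Bd : BettiHodgeData ℂ) (hB : BettiClauses coeffC₀ Bd) (K : Type) [Field K] [NumberField K]
      [IsGalois ℚ K] [NumberField.IsCMField K] (C : CornerProduct K), Hyp.Iwasawa2019_Prop4_4 (M4 Bd hB K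
      C).toNAut3.sA.d41.L₂ (M4 Bd hB K C).toNAut3.sA.d41.triv₂)
    -- (iii) the five N4.1 placement data `Pl In Sp LQ Kd` per side (rows 112–116 / 155–159 of ₂) are the fields of the carrier's
    -- bundle `d41p : PlacedLDatum` (t6-p4, T6N41Placed, decision (8)) [RE-TYPED: DATA 5 per side moved into `M4`, content unchanged];
    -- the seven displays are stated on the bundle's fields; `hdich` / `hκ'` are `d41p.Dich` / `d41p.Kappa'` (NOT bundled, decision (8))
    (hLR7A : ∀ (Bd : BettiHodgeData ℂ) (hB : BettiClauses coeffC₀ Bd) (K : Type) [Field K] [NumberField K]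
      [IsGalois ℚ K] [NumberField.IsCMField K] (C : CornerProduct K), Hyp.LapidRallis2005_Sec7_Unramified (M4 Bd
      hB K C).toNAut3.sA.d41 (M4 Bd hB K C).sA.d41p.Pl)
    (hBumpA : ∀ (Bd : BettiHodgeData ℂ) (hB : BettiClauses coeffC₀ Bd) (K : Type) [Field K] [NumberField K]
      [IsGalois ℚ K] [NumberField.IsCMField K] (C : CornerProduct K), Hyp.Bump1997_5_22 (M4 Bd hB K
      C).sA.d41p.Pl)
    (hHaA : ∀ (Bd : BettiHodgeData ℂ) (hB : BettiClauses coeffC₀ Bd) (K : Type) [Field K] [NumberField K]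
      [IsGalois ℚ K] [NumberField.IsCMField K] (C : CornerProduct K), Hyp.HarrisII2007_Prop2_2_5_b (M4 Bd hB K
      C).sA.d41p.In)
    (hRoA : ∀ (Bd : BettiHodgeData ℂ) (hB : BettiClauses coeffC₀ Bd) (K : Type) [Field K] [NumberField K]
      [IsGalois ℚ K] [NumberField.IsCMField K] (C : CornerProduct K), Hyp.Rogawski1990_Sec11_4_BC (M4 Bd hB K
      C).sA.d41p.In)
    (hMinA : ∀ (Bd : BettiHodgeData ℂ) (hB : BettiClauses coeffC₀ Bd) (K : Type) [Field K] [NumberField K]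
      [IsGalois ℚ K] [NumberField.IsCMField K] (C : CornerProduct K), Hyp.Minguez2008_Thm1_2_LQ (M4 Bd hB K
      C).sA.d41p.LQ)
    (hB451A : ∀ (Bd : BettiHodgeData ℂ) (hB : BettiClauses coeffC₀ Bd) (K : Type) [Field K] [NumberField K]
      [IsGalois ℚ K] [NumberField.IsCMField K] (C : CornerProduct K), Hyp.Bump1997_Thm4_5_1 (M4 Bd hB K
      C).sA.d41p.LQ)
    (hRaoA : ∀ (Bd : BettiHodgeData ℂ) (hB : BettiClauses coeffC₀ Bd) (K : Type) [Field K] [NumberField K]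
      [IsGalois ℚ K] [NumberField.IsCMField K] (C : CornerProduct K), Hyp.Rao1993_CorA5_1 (M4 Bd hB K
      C).sA.d41p.Kd)
    (hdichA : ∀ (Bd : BettiHodgeData ℂ) (hB : BettiClauses coeffC₀ Bd) (K : Type) [Field K] [NumberField K]
      [IsGalois ℚ K] [NumberField.IsCMField K] (C : CornerProduct K), (M4 Bd hB K C).sA.d41p.Dich)
    (hκ'A : ∀ (Bd : BettiHodgeData ℂ) (hB : BettiClauses coeffC₀ Bd) (K : Type) [Field K] [NumberField K]
      [IsGalois ℚ K] [NumberField.IsCMField K] (C : CornerProduct K), (M4 Bd hB K C).sA.d41p.Kappa')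
    (hRA : ∀ (Bd : BettiHodgeData ℂ) (hB : BettiClauses coeffC₀ Bd) (K : Type) [Field K] [NumberField K]
      [IsGalois ℚ K] [NumberField.IsCMField K] (C : CornerProduct K), Hyp.GQT2014_Thm11_7_ii (M4 Bd hB K
      C).toNAut3.d3.A (M4 Bd hB K C).toNAut3.sA.d41)
    -- the τ′ layer on side A (t6-p4, T6N41Tau*): the pure-tensor test datum, the two GQT displays and t6-p5's
    -- `GQT2014_Prop35_i` at the split / non-split places — in place of v6's `hτ'A` [IR], now DISCHARGED
    (TdA : ∀ (Bd : BettiHodgeData ℂ) (hB : BettiClauses coeffC₀ Bd) (K : Type) [Field K] [NumberField K]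
      [IsGalois ℚ K] [NumberField.IsCMField K] (C : CornerProduct K), TauDatum (M4 Bd hB K C).toNAut3.d3.A (M4
      Bd hB K C).toNAut3.sA)
    (hRIPA : ∀ (Bd : BettiHodgeData ℂ) (hB : BettiClauses coeffC₀ Bd) (K : Type) [Field K] [NumberField K]
      [IsGalois ℚ K] [NumberField.IsCMField K] (C : CornerProduct K), Hyp.GQT2014_Thm11_4_ii_Rallis (TdA Bd hB K
      C))
    (hU116A : ∀ (Bd : BettiHodgeData ℂ) (hB : BettiClauses coeffC₀ Bd) (K : Type) [Field K] [NumberField K]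
      [IsGalois ℚ K] [NumberField.IsCMField K] (C : CornerProduct K), Hyp.GQT2014_Sec11_6_Unramified (TdA Bd hB
      K C))
    (hZsA : ∀ (Bd : BettiHodgeData ℂ) (hB : BettiClauses coeffC₀ Bd) (K : Type) [Field K] [NumberField K]
      [IsGalois ℚ K] [NumberField.IsCMField K] (C : CornerProduct K), ∀ v, Hyp.GQT2014_Prop35_i ((M4 Bd hB K
      C).toNAut3.sA.d42.splitDatum v).pair ((M4 Bd hB K C).toNAut3.sA.d42.zetaSplit v))
    (hZnA : ∀ (Bd : BettiHodgeData ℂ) (hB : BettiClauses coeffC₀ Bd) (K : Type) [Field K] [NumberField K]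
      [IsGalois ℚ K] [NumberField.IsCMField K] (C : CornerProduct K), ∀ v, Hyp.GQT2014_Prop35_i (((M4 Bd hB K
      C).toNAut3.sA.d42.towerDatum v).pair 1) ((M4 Bd hB K C).toNAut3.sA.d42.zetaNonsplit v))
    -- N4.2 block, side B (the same shape as side A)
    (S_shB : ∀ (Bd : BettiHodgeData ℂ) (hB : BettiClauses coeffC₀ Bd) (K : Type) [Field K] [NumberField K]
      [IsGalois ℚ K] [NumberField.IsCMField K] (C : CornerProduct K), N42Flath.FactorizationShape)
    (IsL2AutB : ∀ (Bd : BettiHodgeData ℂ) (hB : BettiClauses coeffC₀ Bd) (K : Type) [Field K] [NumberField K]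
      [IsGalois ℚ K] [NumberField.IsCMField K] (C : CornerProduct K), Submodule ℂ (M4 Bd hB K C).d3r.B.LH →
      Prop)
    (IsFinB : ∀ (Bd : BettiHodgeData ℂ) (hB : BettiClauses coeffC₀ Bd) (K : Type) [Field K] [NumberField K]
      [IsGalois ℚ K] [NumberField.IsCMField K] (C : CornerProduct K), Submodule ℂ (M4 Bd hB K C).d3r.B.LH →
      Prop)
    (hL2B : ∀ (Bd : BettiHodgeData ℂ) (hB : BettiClauses coeffC₀ Bd) (K : Type) [Field K] [NumberField K]
      [IsGalois ℚ K] [NumberField.IsCMField K] (C : CornerProduct K), Hyp.GetzHahn2024_Thm6_5_2 ((M4 Bd hB K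
      C).shapeB (S_shB Bd hB K C) (IsL2AutB Bd hB K C) (IsFinB Bd hB K C)))
    (hAutB : ∀ (Bd : BettiHodgeData ℂ) (hB : BettiClauses coeffC₀ Bd) (K : Type) [Field K] [NumberField K]
      [IsGalois ℚ K] [NumberField.IsCMField K] (C : CornerProduct K), (IsL2AutB Bd hB K C) (M4 Bd hB K
      C).d3r.B.π₀)
    (hFinB : ∀ (Bd : BettiHodgeData ℂ) (hB : BettiClauses coeffC₀ Bd) (K : Type) [Field K] [NumberField K]
      [IsGalois ℚ K] [NumberField.IsCMField K] (C : CornerProduct K), (IsFinB Bd hB K C) (M4 Bd hB K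
      C).d3r.B.π₀)
    (h571B : ∀ (Bd : BettiHodgeData ℂ) (hB : BettiClauses coeffC₀ Bd) (K : Type) [Field K] [NumberField K]
      [IsGalois ℚ K] [NumberField.IsCMField K] (C : CornerProduct K), Hyp.GetzHahn2024_Thm5_7_1 (S_shB Bd hB K
      C))
    (h57nB : ∀ (Bd : BettiHodgeData ℂ) (hB : BettiClauses coeffC₀ Bd) (K : Type) [Field K] [NumberField K]
      [IsGalois ℚ K] [NumberField.IsCMField K] (C : CornerProduct K), Hyp.GetzHahn2024_Sec5_7_Note (S_shB Bd hB
      K C))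
    (spB : ∀ (Bd : BettiHodgeData ℂ) (hB : BettiClauses coeffC₀ Bd) (K : Type) [Field K] [NumberField K]
      [IsGalois ℚ K] [NumberField.IsCMField K] (C : CornerProduct K), (M4 Bd hB K C).toNAut3.sB.d42.SplitPlace →
      (S_shB Bd hB K C).Place)
    (nsB : ∀ (Bd : BettiHodgeData ℂ) (hB : BettiClauses coeffC₀ Bd) (K : Type) [Field K] [NumberField K]
      [IsGalois ℚ K] [NumberField.IsCMField K] (C : CornerProduct K), (M4 Bd hB K
      C).toNAut3.sB.d42.NonsplitPlace → (S_shB Bd hB K C).Place)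
    (readSplitB : ∀ (Bd : BettiHodgeData ℂ) (hB : BettiClauses coeffC₀ Bd) (K : Type) [Field K] [NumberField K]
      [IsGalois ℚ K] [NumberField.IsCMField K] (C : CornerProduct K), ∀ v, N42Flath.ReadAs ((S_shB Bd hB K
      C).components (h571B Bd hB K C) (h57nB Bd hB K C) ((hL2B Bd hB K C) (hAutB Bd hB K C) (hFinB Bd hB K C))
      (spB Bd hB K C v)) ((M4 Bd hB K C).toNAut3.sB.d42.splitDatum v).pair.π)
    (readNonsplitB : ∀ (Bd : BettiHodgeData ℂ) (hB : BettiClauses coeffC₀ Bd) (K : Type) [Field K] [NumberField K]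
      [IsGalois ℚ K] [NumberField.IsCMField K] (C : CornerProduct K), ∀ v, N42Flath.ReadAs ((S_shB Bd hB K
      C).components (h571B Bd hB K C) (h57nB Bd hB K C) ((hL2B Bd hB K C) (hAutB Bd hB K C) (hFinB Bd hB K C))
      (nsB Bd hB K C v)) ((M4 Bd hB K C).toNAut3.sB.d42.towerDatum v).π)
    (hspB : ∀ (Bd : BettiHodgeData ℂ) (hB : BettiClauses coeffC₀ Bd) (K : Type) [Field K] [NumberField K]
      [IsGalois ℚ K] [NumberField.IsCMField K] (C : CornerProduct K), ∀ v, (readSplitB Bd hB K C v).IsReading)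
    (hnsB : ∀ (Bd : BettiHodgeData ℂ) (hB : BettiClauses coeffC₀ Bd) (K : Type) [Field K] [NumberField K]
      [IsGalois ℚ K] [NumberField.IsCMField K] (C : CornerProduct K), ∀ v, (readNonsplitB Bd hB K C
      v).IsReading)
    (FB : ∀ (Bd : BettiHodgeData ℂ) (hB : BettiClauses coeffC₀ Bd) (K : Type) [Field K] [NumberField K]
      [IsGalois ℚ K] [NumberField.IsCMField K] (C : CornerProduct K), N42Flath.FirstLiftSide (M4 Bd hB K
      C).d3r.B.LH (M4 Bd hB K C).d3r.B.Hf (M4 Bd hB K C).d3r.B.R (M4 Bd hB K C).d3r.B.π₀)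
    (hLiftB : ∀ (Bd : BettiHodgeData ℂ) (hB : BettiClauses coeffC₀ Bd) (K : Type) [Field K] [NumberField K]
      [IsGalois ℚ K] [NumberField.IsCMField K] (C : CornerProduct K), (FB Bd hB K C).IsLift)
    (readB : ∀ (Bd : BettiHodgeData ℂ) (hB : BettiClauses coeffC₀ Bd) (K : Type) [Field K] [NumberField K]
      [IsGalois ℚ K] [NumberField.IsCMField K] (C : CornerProduct K), ∀ v : (M4 Bd hB K
      C).toNAut3.sB.d42.NonsplitPlace, N42Flath.ReadAtPlace ((FB Bd hB K C).toGlobalLiftDatum (hLiftB Bd hB K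
      C)) (((M4 Bd hB K C).toNAut3.sB.d42.towerDatum v).ω 0) ((M4 Bd hB K C).toNAut3.sB.d42.towerDatum v).π
      (T5TrivialPartner.charLinRep ((M4 Bd hB K C).toNAut3.sB.d42.β' v)))
    (hreadB : ∀ (Bd : BettiHodgeData ℂ) (hB : BettiClauses coeffC₀ Bd) (K : Type) [Field K] [NumberField K]
      [IsGalois ℚ K] [NumberField.IsCMField K] (C : CornerProduct K), ∀ v, (readB Bd hB K C v).IsReading)
    (hposB : ∀ (Bd : BettiHodgeData ℂ) (hB : BettiClauses coeffC₀ Bd) (K : Type) [Field K] [NumberField K]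
      [IsGalois ℚ K] [NumberField.IsCMField K] (C : CornerProduct K), ∀ v, 0 < ((M4 Bd hB K
      C).toNAut3.sB.d42.splitDatum v).n)
    (hnmB : ∀ (Bd : BettiHodgeData ℂ) (hB : BettiClauses coeffC₀ Bd) (K : Type) [Field K] [NumberField K]
      [IsGalois ℚ K] [NumberField.IsCMField K] (C : CornerProduct K), (M4 Bd hB K C).toNAut3.sB.d42.TypeIISizes)
    (hMB : ∀ (Bd : BettiHodgeData ℂ) (hB : BettiClauses coeffC₀ Bd) (K : Type) [Field K] [NumberField K]
      [IsGalois ℚ K] [NumberField.IsCMField K] (C : CornerProduct K), ∀ v, Hyp.Minguez2008_Theoreme1_2 ((M4 Bd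
      hB K C).toNAut3.sB.d42.splitDatum v))
    (hGIB : ∀ (Bd : BettiHodgeData ℂ) (hB : BettiClauses coeffC₀ Bd) (K : Type) [Field K] [NumberField K]
      [IsGalois ℚ K] [NumberField.IsCMField K] (C : CornerProduct K), ∀ v, Hyp.GanIchino2014_Prop5_3_i ((M4 Bd
      hB K C).toNAut3.sB.d42.towerDatum v))
    (hB₁B : ∀ (Bd : BettiHodgeData ℂ) (hB : BettiClauses coeffC₀ Bd) (K : Type) [Field K] [NumberField K]
      [IsGalois ℚ K] [NumberField.IsCMField K] (C : CornerProduct K), Hyp.GQT2014_Conj11_5_obvious ((M4 Bd hB K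
      C).toNAut3.sB.d43.withLfac fun j => (M4 Bd hB K C).toNAut3.sB.d41.Lv (Sum.inr j)).d₁ (M4 Bd hB K
      C).toNAut3.sB.d41 (Sum.inr 0))
    (hB₂B : ∀ (Bd : BettiHodgeData ℂ) (hB : BettiClauses coeffC₀ Bd) (K : Type) [Field K] [NumberField K]
      [IsGalois ℚ K] [NumberField.IsCMField K] (C : CornerProduct K), Hyp.GQT2014_Conj11_5_obvious ((M4 Bd hB K
      C).toNAut3.sB.d43.withLfac fun j => (M4 Bd hB K C).toNAut3.sB.d41.Lv (Sum.inr j)).d₂ (M4 Bd hB K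
      C).toNAut3.sB.d41 (Sum.inr 1))
    (hB₃B : ∀ (Bd : BettiHodgeData ℂ) (hB : BettiClauses coeffC₀ Bd) (K : Type) [Field K] [NumberField K]
      [IsGalois ℚ K] [NumberField.IsCMField K] (C : CornerProduct K), Hyp.GQT2014_Conj11_5_obvious ((M4 Bd hB K
      C).toNAut3.sB.d43.withLfac fun j => (M4 Bd hB K C).toNAut3.sB.d41.Lv (Sum.inr j)).d₃ (M4 Bd hB K
      C).toNAut3.sB.d41 (Sum.inr 2))
    (hGQTB : ∀ (Bd : BettiHodgeData ℂ) (hB : BettiClauses coeffC₀ Bd) (K : Type) [Field K] [NumberField K]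
      [IsGalois ℚ K] [NumberField.IsCMField K] (C : CornerProduct K), Hyp.GQT2014_Thm11_4_ii (M4 Bd hB K
      C).toNAut3.sB.d41)
    (hLRB : ∀ (Bd : BettiHodgeData ℂ) (hB : BettiClauses coeffC₀ Bd) (K : Type) [Field K] [NumberField K]
      [IsGalois ℚ K] [NumberField.IsCMField K] (C : CornerProduct K), Hyp.LapidRallis2005_Sec10_GlobalL (M4 Bd
      hB K C).toNAut3.sB.d41)
    (hpadicB : ∀ (Bd : BettiHodgeData ℂ) (hB : BettiClauses coeffC₀ Bd) (K : Type) [Field K] [NumberField K]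
      [IsGalois ℚ K] [NumberField.IsCMField K] (C : CornerProduct K), Hyp.LapidRallis2005_Sec10_padic (M4 Bd hB
      K C).toNAut3.sB.d41 (M4 Bd hB K C).toNAut3.sB.archSet)
    (hI₁eB : ∀ (Bd : BettiHodgeData ℂ) (hB : BettiClauses coeffC₀ Bd) (K : Type) [Field K] [NumberField K]
      [IsGalois ℚ K] [NumberField.IsCMField K] (C : CornerProduct K), Hyp.Iwasawa2019_Sec3_1_EulerProductE (M4
      Bd hB K C).toNAut3.sB.d41.L₁ (M4 Bd hB K C).toNAut3.sB.d41.g₁)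
    (hI₂eB : ∀ (Bd : BettiHodgeData ℂ) (hB : BettiClauses coeffC₀ Bd) (K : Type) [Field K] [NumberField K]
      [IsGalois ℚ K] [NumberField.IsCMField K] (C : CornerProduct K), Hyp.Iwasawa2019_Sec3_1_EulerProductE (M4
      Bd hB K C).toNAut3.sB.d41.L₂ (M4 Bd hB K C).toNAut3.sB.d41.g₂)
    (hI₁B : ∀ (Bd : BettiHodgeData ℂ) (hB : BettiClauses coeffC₀ Bd) (K : Type) [Field K] [NumberField K]
      [IsGalois ℚ K] [NumberField.IsCMField K] (C : CornerProduct K), Hyp.Iwasawa2019_Thm3_1 (M4 Bd hB K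
      C).toNAut3.sB.d41.L₁ (M4 Bd hB K C).toNAut3.sB.d41.triv₁)
    (hI₂B : ∀ (Bd : BettiHodgeData ℂ) (hB : BettiClauses coeffC₀ Bd) (K : Type) [Field K] [NumberField K]
      [IsGalois ℚ K] [NumberField.IsCMField K] (C : CornerProduct K), Hyp.Iwasawa2019_Thm3_1 (M4 Bd hB K
      C).toNAut3.sB.d41.L₂ (M4 Bd hB K C).toNAut3.sB.d41.triv₂)
    (hP₁B : ∀ (Bd : BettiHodgeData ℂ) (hB : BettiClauses coeffC₀ Bd) (K : Type) [Field K] [NumberField K]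
      [IsGalois ℚ K] [NumberField.IsCMField K] (C : CornerProduct K), Hyp.Iwasawa2019_Prop4_4 (M4 Bd hB K
      C).toNAut3.sB.d41.L₁ (M4 Bd hB K C).toNAut3.sB.d41.triv₁)
    (hP₂B : ∀ (Bd : BettiHodgeData ℂ) (hB : BettiClauses coeffC₀ Bd) (K : Type) [Field K] [NumberField K]
      [IsGalois ℚ K] [NumberField.IsCMField K] (C : CornerProduct K), Hyp.Iwasawa2019_Prop4_4 (M4 Bd hB K
      C).toNAut3.sB.d41.L₂ (M4 Bd hB K C).toNAut3.sB.d41.triv₂)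
    (hLR7B : ∀ (Bd : BettiHodgeData ℂ) (hB : BettiClauses coeffC₀ Bd) (K : Type) [Field K] [NumberField K]
      [IsGalois ℚ K] [NumberField.IsCMField K] (C : CornerProduct K), Hyp.LapidRallis2005_Sec7_Unramified (M4 Bd
      hB K C).toNAut3.sB.d41 (M4 Bd hB K C).sB.d41p.Pl)
    (hBumpB : ∀ (Bd : BettiHodgeData ℂ) (hB : BettiClauses coeffC₀ Bd) (K : Type) [Field K] [NumberField K]
      [IsGalois ℚ K] [NumberField.IsCMField K] (C : CornerProduct K), Hyp.Bump1997_5_22 (M4 Bd hB K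
      C).sB.d41p.Pl)
    (hHaB : ∀ (Bd : BettiHodgeData ℂ) (hB : BettiClauses coeffC₀ Bd) (K : Type) [Field K] [NumberField K]
      [IsGalois ℚ K] [NumberField.IsCMField K] (C : CornerProduct K), Hyp.HarrisII2007_Prop2_2_5_b (M4 Bd hB K
      C).sB.d41p.In)
    (hRoB : ∀ (Bd : BettiHodgeData ℂ) (hB : BettiClauses coeffC₀ Bd) (K : Type) [Field K] [NumberField K]
      [IsGalois ℚ K] [NumberField.IsCMField K] (C : CornerProduct K), Hyp.Rogawski1990_Sec11_4_BC (M4 Bd hB K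
      C).sB.d41p.In)
    (hMinB : ∀ (Bd : BettiHodgeData ℂ) (hB : BettiClauses coeffC₀ Bd) (K : Type) [Field K] [NumberField K]
      [IsGalois ℚ K] [NumberField.IsCMField K] (C : CornerProduct K), Hyp.Minguez2008_Thm1_2_LQ (M4 Bd hB K
      C).sB.d41p.LQ)
    (hB451B : ∀ (Bd : BettiHodgeData ℂ) (hB : BettiClauses coeffC₀ Bd) (K : Type) [Field K] [NumberField K]
      [IsGalois ℚ K] [NumberField.IsCMField K] (C : CornerProduct K), Hyp.Bump1997_Thm4_5_1 (M4 Bd hB K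
      C).sB.d41p.LQ)
    (hRaoB : ∀ (Bd : BettiHodgeData ℂ) (hB : BettiClauses coeffC₀ Bd) (K : Type) [Field K] [NumberField K]
      [IsGalois ℚ K] [NumberField.IsCMField K] (C : CornerProduct K), Hyp.Rao1993_CorA5_1 (M4 Bd hB K
      C).sB.d41p.Kd)
    (hdichB : ∀ (Bd : BettiHodgeData ℂ) (hB : BettiClauses coeffC₀ Bd) (K : Type) [Field K] [NumberField K]
      [IsGalois ℚ K] [NumberField.IsCMField K] (C : CornerProduct K), (M4 Bd hB K C).sB.d41p.Dich)
    (hκ'B : ∀ (Bd : BettiHodgeData ℂ) (hB : BettiClauses coeffC₀ Bd) (K : Type) [Field K] [NumberField K]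
      [IsGalois ℚ K] [NumberField.IsCMField K] (C : CornerProduct K), (M4 Bd hB K C).sB.d41p.Kappa')
    (hRB : ∀ (Bd : BettiHodgeData ℂ) (hB : BettiClauses coeffC₀ Bd) (K : Type) [Field K] [NumberField K]
      [IsGalois ℚ K] [NumberField.IsCMField K] (C : CornerProduct K), Hyp.GQT2014_Thm11_7_ii (M4 Bd hB K
      C).toNAut3.d3.B (M4 Bd hB K C).toNAut3.sB.d41)
    -- the τ′ layer on side B (t6-p4, T6N41Tau*): the pure-tensor test datum, the two GQT displays and t6-p5's
    -- `GQT2014_Prop35_i` at the split / non-split places — in place of v6's `hτ'B` [IR], now DISCHARGED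
    (TdB : ∀ (Bd : BettiHodgeData ℂ) (hB : BettiClauses coeffC₀ Bd) (K : Type) [Field K] [NumberField K]
      [IsGalois ℚ K] [NumberField.IsCMField K] (C : CornerProduct K), TauDatum (M4 Bd hB K C).toNAut3.d3.B (M4
      Bd hB K C).toNAut3.sB)
    (hRIPB : ∀ (Bd : BettiHodgeData ℂ) (hB : BettiClauses coeffC₀ Bd) (K : Type) [Field K] [NumberField K]
      [IsGalois ℚ K] [NumberField.IsCMField K] (C : CornerProduct K), Hyp.GQT2014_Thm11_4_ii_Rallis (TdB Bd hB K
      C))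
    (hU116B : ∀ (Bd : BettiHodgeData ℂ) (hB : BettiClauses coeffC₀ Bd) (K : Type) [Field K] [NumberField K]
      [IsGalois ℚ K] [NumberField.IsCMField K] (C : CornerProduct K), Hyp.GQT2014_Sec11_6_Unramified (TdB Bd hB
      K C))
    (hZsB : ∀ (Bd : BettiHodgeData ℂ) (hB : BettiClauses coeffC₀ Bd) (K : Type) [Field K] [NumberField K]
      [IsGalois ℚ K] [NumberField.IsCMField K] (C : CornerProduct K), ∀ v, Hyp.GQT2014_Prop35_i ((M4 Bd hB K
      C).toNAut3.sB.d42.splitDatum v).pair ((M4 Bd hB K C).toNAut3.sB.d42.zetaSplit v))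
    (hZnB : ∀ (Bd : BettiHodgeData ℂ) (hB : BettiClauses coeffC₀ Bd) (K : Type) [Field K] [NumberField K]
      [IsGalois ℚ K] [NumberField.IsCMField K] (C : CornerProduct K), ∀ v, Hyp.GQT2014_Prop35_i (((M4 Bd hB K
      C).toNAut3.sB.d42.towerDatum v).pair 1) ((M4 Bd hB K C).toNAut3.sB.d42.zetaNonsplit v))
    -- N5 (t6-p7, RE-CUT ON THE RICH DATUM — T6N5Rich / T6N5RichMain / T6N5RichSH): Theorem 5.6 on the datum's two
    -- sides [PO]; the rich datum `R5` with `hR5` [EX, by construction]; the construction facts `hL` [EX — N5.L1 ×2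
    -- a theorem]; (S–H) through N2's `M.AdmDatum` via `dict` / `hA` / `hB` [EX — (a) ×2 a theorem]; the local
    -- solutions `hsol` [EX, witnessed per place by t6-p8 — (b) at the finite places a theorem]; (b) at the real
    -- places `hre` [IR here; display-level discharge in T6N5RealPlace + T6N5FockMain]; (c) `hc5` [EX]
    (hT : ∀ (Bd : BettiHodgeData ℂ) (hB : BettiClauses coeffC₀ Bd) (K : Type) [Field K] [NumberField K]
      [IsGalois ℚ K] [NumberField.IsCMField K] (C : CornerProduct K), Hyp.BFGYYZ2025_Thm5_6 ({(M4 Bd hB K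
      C).toNAut3.d5.A, (M4 Bd hB K C).toNAut3.d5.B} : Set (ToricSide (M4 Bd hB K C).toNAut3.ι5 (M4 Bd hB K
      C).toNAut3.G5)))
    (R5 : ∀ (Bd : BettiHodgeData ℂ) (hB : BettiClauses coeffC₀ Bd) (K : Type) [Field K] [NumberField K]
      [IsGalois ℚ K] [NumberField.IsCMField K] (C : CornerProduct K), N5Rich.RichData (M4 Bd hB K C).toNAut3.ι5
      (M4 Bd hB K C).toNAut3.G5)
    (hR5 : ∀ (Bd : BettiHodgeData ℂ) (hB : BettiClauses coeffC₀ Bd) (K : Type) [Field K] [NumberField K]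
      [IsGalois ℚ K] [NumberField.IsCMField K] (C : CornerProduct K), (M4 Bd hB K C).toNAut3.d5 = (R5 Bd hB K
      C).toN5Data)
    (hL : ∀ (Bd : BettiHodgeData ℂ) (hB : BettiClauses coeffC₀ Bd) (K : Type) [Field K] [NumberField K]
      [IsGalois ℚ K] [NumberField.IsCMField K] (C : CornerProduct K), (R5 Bd hB K C).LevelHyps)
    (dict : ∀ (Bd : BettiHodgeData ℂ) (hB : BettiClauses coeffC₀ Bd) (K : Type) [Field K] [NumberField K]
      [IsGalois ℚ K] [NumberField.IsCMField K] (C : CornerProduct K), (M4 Bd hB K C).toNAut3.d2.Char →* (M4 Bd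
      hB K C).toNAut3.G5)
    (hA : ∀ (Bd : BettiHodgeData ℂ) (hB : BettiClauses coeffC₀ Bd) (K : Type) [Field K] [NumberField K]
      [IsGalois ℚ K] [NumberField.IsCMField K] (C : CornerProduct K), (R5 Bd hB K C).rA = (dict Bd hB K C) ((M4
      Bd hB K C).toNAut3.d2.χ₁₁₁ * (M4 Bd hB K C).toNAut3.d2.χ₁₀₀))
    (hB : ∀ (Bd : BettiHodgeData ℂ) (hB : BettiClauses coeffC₀ Bd) (K : Type) [Field K] [NumberField K]
      [IsGalois ℚ K] [NumberField.IsCMField K] (C : CornerProduct K), (R5 Bd hB K C).rB = (dict Bd hB K C) ((M4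
      Bd hB K C).toNAut3.d2.χ₁₀₁ * (M4 Bd hB K C).toNAut3.d2.χ₁₁₀))
    -- RS-N5 rows 182–183 of ₂ (`hsol` / `hre`, RESIDUAL −2, decision (4)) DISCHARGED on the SIGN MODEL OF A PLACE FAMILY (t6-p8,
    -- T6N5LocalSignModel p437569; t6-p8's OPTION A, STATUS l. 12835) IN THE (C) FORM (t6-p7, T6N5SignModelCMDisplaysLi p442494; the
    -- lead's l. 12851 (iii)): the places of the N side as a place family `F5` over `(K⁺, K)` [DATA] with the per-place hypotheses
    -- `hF5` (the five local displays consumed BY NAME inside `LocalInput.Hyps` + the Weil carrier's smoothness facts + `ϵ_δ(W) = 1` +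
    -- `χ_W` conjugate-symplectic) [RESIDUAL, AD], the real-place bundle of both sides in the (C) form `RP5 : RealPlaceBundleLi`
    -- (the real data, the KK07 carriers, Li's line carriers, the direction units and the bridge facts as declared EX fields) [DATA],
    -- the construction equation `hS5` [EX], and at every real place on both sides the restricted Epsilon Dichotomy (BFGYYZ 2025
    -- Thm 3.5, smooth form) [DISPLAY ×2], Li 1990 eq. (3.2) on the Li carrier (Duke print deposited) [DISPLAY ×2] and KK07 Fact 5.1
    -- on the KK07 carrier (held layer) [DISPLAY ×2] — the archimedean Fock dictionary is a THEOREM of these (`fockDictCO_of_displays_Li`;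
    -- IR 0 at the real places); `hsol` / `hre` are the two components of the seam `PlaceFamily.solves_realCondB_of_eq_displays_Li`
    (F5 : ∀ (Bd : BettiHodgeData ℂ) (hB : BettiClauses coeffC₀ Bd) (K : Type) [Field K] [NumberField K]
      [IsGalois ℚ K] [NumberField.IsCMField K] (C : CornerProduct K), N5LocalSignModel.PlaceFamily
      (NumberField.maximalRealSubfield K) K (M4 Bd hB K C).toNAut3.ι5)
    (hF5 : ∀ (Bd : BettiHodgeData ℂ) (hB : BettiClauses coeffC₀ Bd) (K : Type) [Field K] [NumberField K]
      [IsGalois ℚ K] [NumberField.IsCMField K] (C : CornerProduct K), (F5 Bd hB K C).Hyps)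
    (RP5 : ∀ (Bd : BettiHodgeData ℂ) (hB : BettiClauses coeffC₀ Bd) (K : Type) [Field K] [NumberField K]
      [IsGalois ℚ K] [NumberField.IsCMField K] (C : CornerProduct K), N5Fock.RealPlaceBundleLi (M4 Bd hB K
      C).toNAut3.ι5)
    (hS5 : ∀ (Bd : BettiHodgeData ℂ) (hB : BettiClauses coeffC₀ Bd) (K : Type) [Field K] [NumberField K]
      [IsGalois ℚ K] [NumberField.IsCMField K] (C : CornerProduct K), (R5 Bd hB K C).S = (F5 Bd hB K
      C).signModel (hF5 Bd hB K C) (RP5 Bd hB K C).RA (RP5 Bd hB K C).RB)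
    (h35A5 : ∀ (Bd : BettiHodgeData ℂ) (hB : BettiClauses coeffC₀ Bd) (K : Type) [Field K] [NumberField K]
      [IsGalois ℚ K] [NumberField.IsCMField K] (C : CornerProduct K), ∀ v, (F5 Bd hB K C).kind v = .re →
      Hyp.BFGYYZ2025_Thm3_5_smooth ((RP5 Bd hB K C).RA v).toLocal (fun _ => True))
    (h35B5 : ∀ (Bd : BettiHodgeData ℂ) (hB : BettiClauses coeffC₀ Bd) (K : Type) [Field K] [NumberField K]
      [IsGalois ℚ K] [NumberField.IsCMField K] (C : CornerProduct K), ∀ v, (F5 Bd hB K C).kind v = .re →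
      Hyp.BFGYYZ2025_Thm3_5_smooth ((RP5 Bd hB K C).RB v).toLocal (fun _ => True))
    (hLiA5 : ∀ (Bd : BettiHodgeData ℂ) (hB : BettiClauses coeffC₀ Bd) (K : Type) [Field K] [NumberField K]
      [IsGalois ℚ K] [NumberField.IsCMField K] (C : CornerProduct K), ∀ v, (F5 Bd hB K C).kind v = .re →
      Hyp.Li1990_eq32_lines ((RP5 Bd hB K C).LA v))
    (hLiB5 : ∀ (Bd : BettiHodgeData ℂ) (hB : BettiClauses coeffC₀ Bd) (K : Type) [Field K] [NumberField K]
      [IsGalois ℚ K] [NumberField.IsCMField K] (C : CornerProduct K), ∀ v, (F5 Bd hB K C).kind v = .re →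
      Hyp.Li1990_eq32_lines ((RP5 Bd hB K C).LB v))
    (h51A5 : ∀ (Bd : BettiHodgeData ℂ) (hB : BettiClauses coeffC₀ Bd) (K : Type) [Field K] [NumberField K]
      [IsGalois ℚ K] [NumberField.IsCMField K] (C : CornerProduct K), ∀ v, (F5 Bd hB K C).kind v = .re →
      Hyp.KonnoKonno2007_Fact5_1_compact ((RP5 Bd hB K C).CA v))
    (h51B5 : ∀ (Bd : BettiHodgeData ℂ) (hB : BettiClauses coeffC₀ Bd) (K : Type) [Field K] [NumberField K]
      [IsGalois ℚ K] [NumberField.IsCMField K] (C : CornerProduct K), ∀ v, (F5 Bd hB K C).kind v = .re →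
      Hyp.KonnoKonno2007_Fact5_1_compact ((RP5 Bd hB K C).CB v))
    (hc5 : ∀ (Bd : BettiHodgeData ℂ) (hB : BettiClauses coeffC₀ Bd) (K : Type) [Field K] [NumberField K]
      [IsGalois ℚ K] [NumberField.IsCMField K] (C : CornerProduct K), (M4 Bd hB K C).toNAut3.d5.condC),
    HostAPI.HCCM.Statement

end Summit.Ventures.HodgeRepro2.T6

end
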